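import Mathlib

/-!
# Solo-blind O1b, E73: elements of a principal ideal with a non-zero-divisor generator

Ring-theoretic core of THEOREM Φ12 / Φ12′ (gap law and value-set law) of the solo-blind
Eisenstein study (`paper/theoremPhi.md` §5(o)).  There the Eisenstein ideal is `I = η T` with
`η` a non-zero-divisor of the local Hecke algebra `T`, and every Hecke generator `η_p ∈ I` is
written `η_p = η u_p`; the local component-group exponent is `c_M(p) = log [I : η_p T]
= log [T : u_p T]`, which vanishes iff `u_p` is a unit and otherwise is at least `δ_T`.  The three
lemmas below are the abstract steps: the cofactor `u` is unique, `η u` generates `(η)` iff `u` is a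
unit, and in a local ring an element of `(η)` either generates `(η)` or lies in `𝔪 · (η)`.
-/

namespace Summit.Langlands.Langlands.Theorems

/-- **E73a.** If `η` is a non-zero-divisor, every element of the principal ideal `(η)` has a
unique cofactor: `x = η * u` for exactly one `u`. -/
theorem soloBlind_existsUnique_eq_mul_of_mem_span_singleton
    {R : Type*} [CommRing R] {η x : R} (hη : η ∈ nonZeroDivisors R)
    (hx : x ∈ Ideal.span {η}) :
    ∃! u : R, x = η * u := by
  obtain ⟨a, rfl⟩ := Ideal.mem_span_singleton'.mp hx
  refine ⟨a, by ring, fun u hu => ?_⟩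
  -- `a * η = η * u` forces `u = a` since `η` is a non-zero-divisor
  have h0 : (u - a) * η = 0 := by
    rw [sub_mul, mul_comm u η, ← hu]; ring
  have := (mem_nonZeroDivisors_iff.mp hη).2 (u - a) h0
  exact (sub_eq_zero.mp this)

/-- **E73b.** For a non-zero-divisor `η`, the multiple `η * u` generates the same ideal as `η`
if and only if `u` is a unit.  (In THEOREM Φ12: `c_M(p) = 0 ⟺ u_p ∈ T^×`.) -/
theorem soloBlind_span_singleton_mul_eq_span_singleton_iff_isUnit
    {R : Type*} [CommRing R] {η : R} (hη : η ∈ nonZeroDivisors R) (u : R) :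
    Ideal.span {η * u} = Ideal.span {η} ↔ IsUnit u := by
  constructor
  · intro h
    have hmem : η ∈ Ideal.span {η * u} := h ▸ Ideal.mem_span_singleton_self η
    obtain ⟨a, ha⟩ := Ideal.mem_span_singleton'.mp hmem
    -- `a * (η * u) = η` gives `(a * u - 1) * η = 0`, hence `a * u = 1`
    have h0 : (a * u - 1) * η = 0 := by
      rw [sub_mul, one_mul, sub_eq_zero]
      calc a * u * η = a * (η * u) := by ring
        _ = η := ha
    have h1 : a * u - 1 = 0 := (mem_nonZeroDivisors_iff.mp hη).2 _ h0
    have h2 : u * a = 1 := by rw [mul_comm]; exact sub_eq_zero.mp h1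
    exact isUnit_iff_exists_inv.mpr ⟨a, h2⟩
  · intro hu
    exact Ideal.span_singleton_mul_right_unit hu η

/-- **E73c (the dichotomy behind the gap law).** In a commutative local ring, if `η` is a
non-zero-divisor and `x ∈ (η)`, then either `x` generates `(η)` or `x ∈ 𝔪 · (η)`.
(In THEOREM Φ12: either `c_M(p) = 0`, or `η_p ∈ 𝔪_T I` and then `c_M(p) ≥ δ_T`.) -/
theorem soloBlind_span_singleton_eq_or_mem_maximalIdeal_mul
    {R : Type*} [CommRing R] [IsLocalRing R] {η x : R} (hη : η ∈ nonZeroDivisors R)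
    (hx : x ∈ Ideal.span {η}) :
    Ideal.span {x} = Ideal.span {η} ∨ x ∈ IsLocalRing.maximalIdeal R * Ideal.span {η} := by
  obtain ⟨u, hu, -⟩ := soloBlind_existsUnique_eq_mul_of_mem_span_singleton hη hx
  subst hu
  by_cases h : IsUnit u
  · exact Or.inl ((soloBlind_span_singleton_mul_eq_span_singleton_iff_isUnit hη u).mpr h)
  · right
    have hu𝔪 : u ∈ IsLocalRing.maximalIdeal R := (IsLocalRing.mem_maximalIdeal u).mpr h
    rw [mul_comm η u]
    exact Ideal.mul_mem_mul hu𝔪 (Ideal.mem_span_singleton_self η)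

end Summit.Langlands.Langlands.Theorems
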